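import Mathlib
import HarnessLib
import Summits.HubbardSuperconductivity.HubbardSuperconductivity.Theorems.KLProgrammeKLRegimeWickScaleFlowSlice
import Summits.HubbardSuperconductivity.HubbardSuperconductivity.Theorems.KLProgrammeKLRegimeEnginePairLadderApriori

/-!
# Route `KLProgramme` — crux K3, ENGINE child gen 5 (stmt-HubbardSuperconductivity-19918 `KLRegimeEngineV14`), stub `stub_engine_step_values`,
# conjunct (E2-v9/v10) at `1 ≤ n`: the a priori bound on ALL vertex functions of a fixed degree ALONG the slice — `klws_apriori_vertexFn_of_rate`

Cell gate-hubbard-kl, seat hubbard-kl-k3c1-p1 (g6), technique «composed-map remainder propagation».  The bootstrap `kltc_apriori_of_flow` (p507321)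
instantiated on the MODEL: the finite family of degree-`m` vertex functions `t ↦ 𝒱_m(𝒲_{Λ(t)})(X)`, `X : Fin m → HubbardFieldIdx L M`, of the
real-cutoff Wick carrier along the affine path `Λ(t) = Λ₀ + t(Λ₁ − Λ₀)` (`0 < Λ₁ ≤ Λ₀`, `Z^K ≠ 0` on the slice):

* `klws_vertexFn_flowData` — every member is differentiable on `[0,1]` with derivative
  `(Λ₁ − Λ₀)•(−½·𝒱_m(e^{Δ_{D_{Λ(t)}}}(δ𝒱/δψ, Ċ_{Λ(t)} δ𝒱/δψ))(X))` (`klws_hasDerivAt_vertexFn_wickActionR` ∘ path);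
* **`klws_apriori_vertexFn_of_rate`** — if the grid value is bounded, `‖𝒱_m(𝒲_{Λ₀})(X)‖ ≤ m₀` for all `X`, and the source obeys the CONDITIONAL
  rate «whenever `‖𝒱_m(𝒲_{Λ(t)})(X)‖ ≤ mm` for all `X`, then `‖(Λ₁ − Λ₀)·½·𝒱_m(source at Λ(t))(X)‖ ≤ g t` for all `X`» (`g ≥ 0` continuous — the shape
  the two-vertex source bound has: two running vertices of the same cutoff, each `≤ mm`, times gains/line masses), with slack `m₀ + ∫₀¹ g < mm`,
  THEN `‖𝒱_m(𝒲_{Λ(t)})(X)‖ ≤ mm` for every `t ∈ [0,1]` and every `X` — in particular (m = 4) the `hΓm` input of `klws_wickStep_of_scaleFlow` and the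
  sup bound the ph turnkeys read, WITHOUT a norm induction at real cutoffs for this degree;
* `klws_apriori_vertexFn_of_rate_grid` — the same on `[Λ_n, Λ_{n−1}]` keyed on `klWickAction … (n−1)` at the start.

Exact calculus + p507321; the rate function `g` and the grid bound are hypotheses; nothing about superconductivity is asserted.  0 kit.
-/

noncomputable section

namespace Summit.HubbardSuperconductivity.HubbardSuperconductivity.Theorems.KLRegimeWick

set_option linter.dupNamespace false -- summit = problem name (single-conjunct summit), D-0017

open Set Finset Literature.MathematicalPhysics.QuantumLattice GrassmannAlgebra MeasureTheory intervalIntegral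
open Literature.Probability.LatticeModels
open Summit.HubbardSuperconductivity.HubbardSuperconductivity.Theorems.KLProgrammeLegKernels
open Summit.HubbardSuperconductivity.HubbardSuperconductivity.Theorems.KLRegimeSplit
open scoped Topology

section Model

variable (L M : ℕ) [NeZero L] (β U μ : ℝ) (K : TrigPolyC4v)

/-- **Flow data of every vertex function of positive degree along the slice**: for `X : Fin m → HubbardFieldIdx L M`, `0 < m`,
`t ↦ 𝒱_m(𝒲_{Λ(t)})(X)` has derivative `(Λ₁ − Λ₀)•(−½·𝒱_m(e^{Δ_{D_{Λ(t)}}}(δ𝒱_{Λ(t)}/δψ, Ċ_{Λ(t)} δ𝒱_{Λ(t)}/δψ))(X))` at every `t ∈ [0,1]`. -/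
theorem klws_vertexFn_flowData {Λ₀ Λ₁ : ℝ} (h10 : Λ₁ ≤ Λ₀) (h1 : 0 < Λ₁)
    (hZ : ∀ Λ ∈ Icc Λ₁ Λ₀, hubbardEffPartitionFnCT L M β U μ 0 K Λ ≠ 0) {m : ℕ} (hm : 0 < m) {t : ℝ} (ht : t ∈ Icc (0 : ℝ) 1)
    (X : Fin m → HubbardFieldIdx L M) :
    HasDerivAt (fun s : ℝ => vertexFn L M β (gaussConv ℂ (hubbardCovBelowCT L M β μ 0 K (Λ₀ + s * (Λ₁ - Λ₀)))
        (hubbardEffectiveActionCT L M β U μ 0 K (Λ₀ + s * (Λ₁ - Λ₀)))) m X)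
      ((Λ₁ - Λ₀) • -((2 : ℂ)⁻¹ * vertexFn L M β (gaussConv ℂ (hubbardCovBelowCT L M β μ 0 K (Λ₀ + t * (Λ₁ - Λ₀)))
        (grassmannDerivPairing ℂ
          (Matrix.of fun X Y : HubbardFieldIdx L M =>
            deriv (fun Λ'' : ℝ => hubbardCovAboveCT L M β μ 0 K Λ'' X Y) (Λ₀ + t * (Λ₁ - Λ₀)))
          (hubbardEffectiveActionCT L M β U μ 0 K (Λ₀ + t * (Λ₁ - Λ₀)))
          (hubbardEffectiveActionCT L M β U μ 0 K (Λ₀ + t * (Λ₁ - Λ₀))))) m X)) t := by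
  have hne : Λ₀ + t * (Λ₁ - Λ₀) ≠ 0 := (h1.trans_le (klws_affine_mem_Icc h10 ht).1).ne'
  have hZt : hubbardEffPartitionFnCT L M β U μ 0 K (Λ₀ + t * (Λ₁ - Λ₀)) ≠ 0 := hZ _ (klws_affine_mem_Icc h10 ht)
  have hg := klws_hasDerivAt_vertexFn_wickActionR L M β U μ K (klws_hasDerivAt_hardCov_scale L M β μ K hne) hZt hm X
  have h := hg.scomp t (klws_hasDerivAt_affine Λ₀ Λ₁ t)
  simpa only [Function.comp_def] using h

/-- **A priori bound on all degree-`m` vertex functions along the slice, by bootstrap from the flow.**  Slice `[Λ₁, Λ₀]`, `0 < Λ₁ ≤ Λ₀`,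
`Z^K ≠ 0` on it, `0 < m`; start `‖𝒱_m(𝒲_{Λ₀})(X)‖ ≤ m₀` (`0 ≤ m₀`) for all `X`; `g ≥ 0` continuous on `[0,1]`; CONDITIONAL RATE: for `t ∈ [0,1)`, if
`‖𝒱_m(𝒲_{Λ(t)})(X)‖ ≤ mm` for all `X` then `‖(Λ₁ − Λ₀)•(−½·𝒱_m(e^{Δ_{D_{Λ(t)}}}(δ𝒱/δψ, Ċ_{Λ(t)} δ𝒱/δψ))(X))‖ ≤ g t` for all `X`; slack
`m₀ + ∫₀¹ g < mm`.  THEN `‖𝒱_m(𝒲_{Λ(t)})(X)‖ ≤ mm` for all `t ∈ [0,1]`, all `X`. -/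
theorem klws_apriori_vertexFn_of_rate {Λ₀ Λ₁ : ℝ} (h10 : Λ₁ ≤ Λ₀) (h1 : 0 < Λ₁)
    (hZ : ∀ Λ ∈ Icc Λ₁ Λ₀, hubbardEffPartitionFnCT L M β U μ 0 K Λ ≠ 0) {m : ℕ} (hm : 0 < m) (g : ℝ → ℝ) {mm m₀ : ℝ}
    (hm₀ : 0 ≤ m₀) (hg : ContinuousOn g (Icc 0 1)) (hg0 : ∀ t ∈ Icc (0 : ℝ) 1, 0 ≤ g t)
    (h0 : ∀ X : Fin m → HubbardFieldIdx L M,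
      ‖vertexFn L M β (gaussConv ℂ (hubbardCovBelowCT L M β μ 0 K Λ₀) (hubbardEffectiveActionCT L M β U μ 0 K Λ₀)) m X‖ ≤ m₀)
    (hrate : ∀ t ∈ Ico (0 : ℝ) 1,
      (∀ X : Fin m → HubbardFieldIdx L M,
        ‖vertexFn L M β (gaussConv ℂ (hubbardCovBelowCT L M β μ 0 K (Λ₀ + t * (Λ₁ - Λ₀)))
          (hubbardEffectiveActionCT L M β U μ 0 K (Λ₀ + t * (Λ₁ - Λ₀)))) m X‖ ≤ mm) →
      ∀ X : Fin m → HubbardFieldIdx L M,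
        ‖(Λ₁ - Λ₀) • -((2 : ℂ)⁻¹ * vertexFn L M β (gaussConv ℂ (hubbardCovBelowCT L M β μ 0 K (Λ₀ + t * (Λ₁ - Λ₀)))
          (grassmannDerivPairing ℂ
            (Matrix.of fun X Y : HubbardFieldIdx L M =>
              deriv (fun Λ'' : ℝ => hubbardCovAboveCT L M β μ 0 K Λ'' X Y) (Λ₀ + t * (Λ₁ - Λ₀)))
            (hubbardEffectiveActionCT L M β U μ 0 K (Λ₀ + t * (Λ₁ - Λ₀)))
            (hubbardEffectiveActionCT L M β U μ 0 K (Λ₀ + t * (Λ₁ - Λ₀))))) m X)‖ ≤ g t)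
    (hslack : m₀ + ∫ t in (0 : ℝ)..1, g t < mm) :
    ∀ t ∈ Icc (0 : ℝ) 1, ∀ X : Fin m → HubbardFieldIdx L M,
      ‖vertexFn L M β (gaussConv ℂ (hubbardCovBelowCT L M β μ 0 K (Λ₀ + t * (Λ₁ - Λ₀)))
        (hubbardEffectiveActionCT L M β U μ 0 K (Λ₀ + t * (Λ₁ - Λ₀)))) m X‖ ≤ mm := by
  have h := kltc_apriori_of_flow_le (κ := Fin m → HubbardFieldIdx L M)
    (fun s X => vertexFn L M β (gaussConv ℂ (hubbardCovBelowCT L M β μ 0 K (Λ₀ + s * (Λ₁ - Λ₀)))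
      (hubbardEffectiveActionCT L M β U μ 0 K (Λ₀ + s * (Λ₁ - Λ₀)))) m X)
    (fun s X => (Λ₁ - Λ₀) • -((2 : ℂ)⁻¹ * vertexFn L M β (gaussConv ℂ (hubbardCovBelowCT L M β μ 0 K (Λ₀ + s * (Λ₁ - Λ₀)))
      (grassmannDerivPairing ℂ
        (Matrix.of fun X Y : HubbardFieldIdx L M =>
          deriv (fun Λ'' : ℝ => hubbardCovAboveCT L M β μ 0 K Λ'' X Y) (Λ₀ + s * (Λ₁ - Λ₀)))
        (hubbardEffectiveActionCT L M β U μ 0 K (Λ₀ + s * (Λ₁ - Λ₀)))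
        (hubbardEffectiveActionCT L M β U μ 0 K (Λ₀ + s * (Λ₁ - Λ₀))))) m X))
    g hm₀ (fun t ht X => klws_vertexFn_flowData L M β U μ K h10 h1 hZ hm ht X) hg hg0 ?_ hrate hslack
  · exact h
  · intro X
    simpa only [zero_mul, add_zero] using h0 X

/-- **Grid form**: on the slice `[Λ_n, Λ_{n−1}]` with the start bound read on p1's `klWickAction … (n−1)`. -/
theorem klws_apriori_vertexFn_of_rate_grid (n : ℕ)
    (hZ : ∀ Λ ∈ Icc (klScale klE0 n) (klScale klE0 (n - 1)), hubbardEffPartitionFnCT L M β U μ 0 K Λ ≠ 0) {m : ℕ} (hm : 0 < m)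
    (g : ℝ → ℝ) {mm m₀ : ℝ} (hm₀ : 0 ≤ m₀) (hg : ContinuousOn g (Icc 0 1)) (hg0 : ∀ t ∈ Icc (0 : ℝ) 1, 0 ≤ g t)
    (h0 : ∀ X : Fin m → HubbardFieldIdx L M, ‖vertexFn L M β (klWickAction L M β U μ K (n - 1)) m X‖ ≤ m₀)
    (hrate : ∀ t ∈ Ico (0 : ℝ) 1,
      (∀ X : Fin m → HubbardFieldIdx L M,
        ‖vertexFn L M β (gaussConv ℂ
          (hubbardCovBelowCT L M β μ 0 K (klScale klE0 (n - 1) + t * (klScale klE0 n - klScale klE0 (n - 1))))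
          (hubbardEffectiveActionCT L M β U μ 0 K (klScale klE0 (n - 1) + t * (klScale klE0 n - klScale klE0 (n - 1))))) m X‖ ≤ mm) →
      ∀ X : Fin m → HubbardFieldIdx L M,
        ‖(klScale klE0 n - klScale klE0 (n - 1)) • -((2 : ℂ)⁻¹ * vertexFn L M β (gaussConv ℂ
          (hubbardCovBelowCT L M β μ 0 K (klScale klE0 (n - 1) + t * (klScale klE0 n - klScale klE0 (n - 1))))
          (grassmannDerivPairing ℂ
            (Matrix.of fun X Y : HubbardFieldIdx L M =>
              deriv (fun Λ'' : ℝ => hubbardCovAboveCT L M β μ 0 K Λ'' X Y)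
                (klScale klE0 (n - 1) + t * (klScale klE0 n - klScale klE0 (n - 1))))
            (hubbardEffectiveActionCT L M β U μ 0 K (klScale klE0 (n - 1) + t * (klScale klE0 n - klScale klE0 (n - 1))))
            (hubbardEffectiveActionCT L M β U μ 0 K (klScale klE0 (n - 1) + t * (klScale klE0 n - klScale klE0 (n - 1)))))) m X)‖ ≤
          g t)
    (hslack : m₀ + ∫ t in (0 : ℝ)..1, g t < mm) :
    ∀ t ∈ Icc (0 : ℝ) 1, ∀ X : Fin m → HubbardFieldIdx L M,
      ‖vertexFn L M β (gaussConv ℂ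
        (hubbardCovBelowCT L M β μ 0 K (klScale klE0 (n - 1) + t * (klScale klE0 n - klScale klE0 (n - 1))))
        (hubbardEffectiveActionCT L M β U μ 0 K (klScale klE0 (n - 1) + t * (klScale klE0 n - klScale klE0 (n - 1))))) m X‖ ≤ mm := by
  obtain ⟨hpos, hle⟩ := klws_klScale_pos_antitone n
  exact klws_apriori_vertexFn_of_rate L M β U μ K hle hpos hZ hm g hm₀ hg hg0 h0 hrate hslack

end Model

end Summit.HubbardSuperconductivity.HubbardSuperconductivity.Theorems.KLRegimeWick

end
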